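import Summits.ValiantsHypothesis.ValiantsHypothesis.Theorems.KPlusLogSqLawTropicalBLexCoreLaws
import Summits.ValiantsHypothesis.ValiantsHypothesis.Theorems.KPlusLogSqLawTropicalBLexCoreCycle
import Summits.ValiantsHypothesis.ValiantsHypothesis.Theorems.KPlusLogSqLawTropicalBLexCoreHall

/-!
# Route «KPlusLogSqLaw», crux `TropicalB` (stmt-ValiantsHypothesis-19771) — LEX-NT, part 3b: THE LEX CORE LAW (all `m ≥ 4`, all `K`)
# no design has dominant terms `c₂^m ≺ c₁^{m−1}c₃ ≺ c₀^{m−2}c₂c₃` (`d c₀ < d c₁ < d c₂ ≤ d c₃`)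

HONEST FRAMING.  Structure law for dominance designs of ANY format (`m ≥ 4`, any `K`, any valuations, any signs), toward the crux
`Summit.ValiantsHypothesis.ValiantsHypothesis.Theses.KPlusLogSqLaw.TropicalB` (item stmt-ValiantsHypothesis-19771, route KPlusLogSqLaw;
cell `pub-symmetroid`, seat val-sym-trop-p5: g13 conjectured it as «LEX-NT» with kernel (`m = 4`, `designRowD_four_four_33_LEX`), exact
(`m = 5`) and located (`m ≤ 9`, 581 868 Latin triples) evidence, g14 proved it, 2026-08-28; `--supports … --as helper`).  It bounds the
census one below counting on every cell where the three slopes are so ordered (part 4); it says nothing about `TropicalB` in its window,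
`WeakLifting`, DoorA26 / DoorA34, `MatrixDescartes` (stmt-ValiantsHypothesis-18050) or VP ≠ VNP.

THE LAW (`lex_core_law`).  `m ≥ 4`; classes `c₀, c₁, c₂, c₃` with `d c₀ < d c₁ < d c₂ ≤ d c₃`.  No design has three terms
`A = (α, every column c₂)`, `B = (β, c₁ off one column bs, c₃ at bs)`, `C = (γ, c₀ off two columns x ≠ y, c₃ at x, c₂ at y)` that are
unique optima at slopes `θ_A < θ_B < θ_C`.
PROOF (a three-body exchange = LATIN TRIPLE, found along an alternating cycle).  Pairwise laws (`sum_d_lt_of_isDominant_invariant`):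
`π = α⁻¹β` is Hamiltonian (`ParityLaw.hamiltonian_quotient`); `ρ = α⁻¹γ` has no fixed column except possibly `y` (`rho_fixed`, part 3a
`…TropicalBLexCoreLaws`); and `β b = γ b` only at `b ∈ {x, y}` (`coincidence`; THIS is where `m ≥ 4` enters for the census: at `m = 3` the configuration `x = bs`,
`γ y = α y`, `γ x = β x` survives and the fast-digit `(3,4)` cell is tight).  The descent lemma (part 1) then gives a column `a ≠ x` with
`pos (ρ a) < pos a` in the `π`-order; the columns of positions `pos (ρ a), …, pos a` carry an `A`-alternating cycle avoiding the two
class-`c₃` incidences (`B`-edges along the `π`-path, one `C`-edge back), whose switch `Q₀` is a present term with `S(Q₀) ≤ S(A)`.  The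
remaining incidences form a `2`-regular bipartite multigraph, split by Kőnig/Hall (part 2) into present terms `Q₁, Q₂`; of the three
special free incidences — `B` at `bs` (class `c₃`), `C` at `x` (class `c₃`), `A` at `a` (class `c₂`) — two lie in the same `Q_i`
(pigeonhole), so that `Q_i` has `S ≥ d c₃ + d c₂ + (m−2) d c₀ = S(C)`.  `(Q₀, Q₁, Q₂)` repackage `(A, B, C)` column by column, and the
multi-exchange law `MultiExchange.prefix_deficit` (`t = 3`, val-sym-trop-p4; packaged as `latin_contra`, part 3a) demands `S(Q₀) > S(A)` or
`S(Q₂) < S(C)` — contradiction.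
[this cell; the exchange laws are the tree's, Kőnig/Hall is Mathlib's]
-/

set_option linter.dupNamespace false
set_option autoImplicit false

namespace Summit.ValiantsHypothesis.ValiantsHypothesis.Theorems.KPlusLogSqLaw

namespace LexCore

open Summit.ValiantsHypothesis.ValiantsHypothesis.Theorems.MatrixDescartes.Negative
open Finset

variable {m K : ℕ}

/-! ## 4. The law -/

/-- **THE LEX CORE LAW (all `m ≥ 4`).**  Classes `c₀ c₁ c₂ c₃` with `d c₀ < d c₁ < d c₂ ≤ d c₃`.  No dominance design (any `K`, `v`, `ε`)
has unique optima `A = (α, all columns c₂)` at `θA`, `B = (β, c₁ off bs, c₃ at bs)` at `θB`, `C = (γ, c₀ off {x, y}, c₃ at x, c₂ at y)`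
(`x ≠ y`) at `θC` with `θA < θB < θC`.  In histogram terms: `c₂^m ≺ c₁^{m−1} c₃ ≺ c₀^{m−2} c₂ c₃` never occur together along a
dominant chain. [this cell] -/
theorem lex_core_law (hm : 4 ≤ m) (d : Fin K → ℕ) (v ε : Fin m → Fin m → Fin K → ℤ) (c₀ c₁ c₂ c₃ : Fin K)
    (h01 : d c₀ < d c₁) (h12 : d c₁ < d c₂) (h23 : d c₂ ≤ d c₃)
    {α β γ : Equiv.Perm (Fin m)} {lA lB lC : Fin m → Fin K} (bs x y : Fin m) (hxy : x ≠ y)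
    (hlA : ∀ b, lA b = c₂) (hlB : ∀ b, b ≠ bs → lB b = c₁) (hbs : lB bs = c₃)
    (hlC : ∀ b, b ≠ x → b ≠ y → lC b = c₀) (hx : lC x = c₃) (hy : lC y = c₂)
    {θA θB θC : ℤ} (hAB : θA < θB) (hBC : θB < θC)
    (hA : IsDominant d v ε θA (α, lA)) (hB : IsDominant d v ε θB (β, lB)) (hC : IsDominant d v ε θC (γ, lC)) : False := by
  classical
  have h02 : d c₀ < d c₂ := h01.trans h12
  have h03 : d c₀ < d c₃ := lt_of_lt_of_le h02 h23
  -- (R1) `π = α⁻¹β` is Hamiltonian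
  obtain ⟨hπmv, hπcyc⟩ := ParityLaw.hamiltonian_quotient d v ε hAB hA hB bs
    (fun b hb => by rw [hlB b hb, hlA b]; exact h12) (by omega)
  set π := α⁻¹ * β with hπdef
  set ρ := α⁻¹ * γ with hρdef
  -- (R2) fixed columns of `ρ` lie in `{y}`
  have hfix : ∀ b, ρ b = b → b = y :=
    fun b hb => rho_fixed (by omega) d v ε (hAB.trans hBC) hA hC c₀ c₂ h02 x y hlA hlC hy b hb
  -- (R3) coincidences lie in `{x, y}`
  have hlBpos : ∀ b, d c₀ < d (lB b) := by
    intro b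
    by_cases hb : b = bs
    · rw [hb, hbs]; exact h03
    · rw [hlB b hb]; exact h01
  have hcoin : ∀ b, π b = ρ b → b = x ∨ b = y := by
    intro b hb
    refine coincidence d v ε hBC hB hC c₀ x y hlBpos hlC b ?_
    have : α (π b) = α (ρ b) := by rw [hb]
    simpa [hπdef, hρdef, Equiv.Perm.mul_apply] using this
  -- the `π`-order and the descent
  obtain ⟨pos, hinj, hlt, hposbs, hstep⟩ := exists_order hπmv hπcyc
  obtain ⟨a, hax, hamv, hdesc⟩ := exists_descent pos hinj hlt hposbs hstep hxy hfix hcoin hm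
  -- positions `i < j` of the cycle ends
  set i := pos (ρ a) with hidef
  set j := pos a with hjdef
  have hjm : j < m := hlt a
  -- the three terms and their row maps
  set T : Fin 3 → Equiv.Perm (Fin m) × (Fin m → Fin K) := ![(α, lA), (β, lB), (γ, lC)] with hT
  have T0 : T 0 = (α, lA) := rfl
  have T1 : T 1 = (β, lB) := rfl
  have T2 : T 2 = (γ, lC) := rfl
  -- the switched matching `M`: `B` on positions `[i, j)`, `C` at position `j` (the column `a`), `A` elsewhere
  set sM : Fin m → Fin 3 := fun b => if i ≤ pos b ∧ pos b < j then 1 else if pos b = j then 2 else 0 with hsM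
  have sM_a : sM a = 2 := by
    simp only [hsM]
    rw [if_neg (fun h => lt_irrefl _ h.2), if_pos rfl]
  have sM_one : ∀ b, sM b = 1 → i ≤ pos b ∧ pos b < j := by
    intro b hb
    simp only [hsM] at hb
    split_ifs at hb with h1 h2
    · exact h1
    · exact absurd hb (by decide)
    · exact absurd hb (by decide)
  have sM_two : ∀ b, sM b = 2 → b = a := by
    intro b hb
    simp only [hsM] at hb
    split_ifs at hb with h1 h2
    · exact absurd hb (by decide)
    · exact hinj h2
    · exact absurd hb (by decide)
  -- the row map of `M`, conjugated by `α⁻¹`, permutes positions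
  have hνpos : ∀ b, pos (α⁻¹ ((T (sM b)).1 b)) =
      (if i ≤ pos b ∧ pos b < j then pos b + 1 else if pos b = j then i else pos b) := by
    intro b
    by_cases h1 : i ≤ pos b ∧ pos b < j
    · have hs : sM b = 1 := by simp only [hsM]; rw [if_pos h1]
      rw [hs, if_pos h1, T1]
      have hbbs : b ≠ bs := by
        intro e; rw [e, hposbs] at h1; omega
      show pos ((α⁻¹ : Equiv.Perm (Fin m)) (β b)) = pos b + 1
      rw [← hstep b hbbs, hπdef, Equiv.Perm.mul_apply]
    · by_cases h2 : pos b = j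
      · have hs : sM b = 2 := by simp only [hsM]; rw [if_neg h1, if_pos h2]
        rw [hs, if_neg h1, if_pos h2, T2, sM_two b hs]
        show pos ((α⁻¹ : Equiv.Perm (Fin m)) (γ a)) = i
        rw [hidef, hρdef, Equiv.Perm.mul_apply]
      · have hs : sM b = 0 := by simp only [hsM]; rw [if_neg h1, if_neg h2]
        rw [hs, if_neg h1, if_neg h2, T0]
        show pos ((α⁻¹ : Equiv.Perm (Fin m)) (α b)) = pos b
        simp
  have hMinj : Function.Injective fun b => (T (sM b)).1 b := by
    intro b b' h
    have h' : pos (α⁻¹ ((T (sM b)).1 b)) = pos (α⁻¹ ((T (sM b')).1 b')) := by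
      simp only at h; rw [h]
    rw [hνpos b, hνpos b'] at h'
    apply hinj
    have hij : i < j := hdesc
    split_ifs at h' <;> omega
  -- the three row maps are injective
  have hr : ∀ s : Fin 3, Function.Injective fun b => (T s).1 b := by
    intro s
    fin_cases s
    · exact α.injective
    · exact β.injective
    · exact γ.injective
  -- Kőnig / Hall: split the free incidences into two transversals
  obtain ⟨s₁, s₂, hs1M, hs2M, hs12, hi₁, hi₂⟩ := two_factor (fun s b => (T s).1 b) hr sM hMinj
  -- the special free incidences: `B` at `bs`, `C` at `x`, `A` at `a`
  have hbs1 : sM bs ≠ 1 := by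
    intro h; have := (sM_one bs h).2; rw [hposbs] at this; omega
  have hx2 : sM x ≠ 2 := fun h => hax (sM_two x h).symm
  have free_bs : s₁ bs = 1 ∨ s₂ bs = 1 := by
    rcases slot_cases (sM bs) (s₁ bs) (s₂ bs) 1 (hs1M bs).symm (hs2M bs).symm (hs12 bs) with h | h | h
    · exact absurd h.symm hbs1
    · exact Or.inl h.symm
    · exact Or.inr h.symm
  have free_x : s₁ x = 2 ∨ s₂ x = 2 := by
    rcases slot_cases (sM x) (s₁ x) (s₂ x) 2 (hs1M x).symm (hs2M x).symm (hs12 x) with h | h | h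
    · exact absurd h.symm hx2
    · exact Or.inl h.symm
    · exact Or.inr h.symm
  have free_a : s₁ a = 0 ∨ s₂ a = 0 := by
    rcases slot_cases (sM a) (s₁ a) (s₂ a) 0 (hs1M a).symm (hs2M a).symm (hs12 a) with h | h | h
    · rw [sM_a] at h; exact absurd h (by decide)
    · exact Or.inl h.symm
    · exact Or.inr h.symm
  -- column-wise facts about classes
  have hlow : ∀ (s : Fin 3) (b : Fin m), (d c₀ : ℤ) ≤ d ((T s).2 b) := by
    intro s b
    fin_cases s
    · show (d c₀ : ℤ) ≤ d (lA b); rw [hlA b]; exact_mod_cast h02.le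
    · show (d c₀ : ℤ) ≤ d (lB b); exact_mod_cast (hlBpos b).le
    · show (d c₀ : ℤ) ≤ d (lC b)
      by_cases hbx : b = x
      · rw [hbx, hx]; exact_mod_cast h03.le
      by_cases hby : b = y
      · rw [hby, hy]; exact_mod_cast h02.le
      rw [hlC b hbx hby]
  have hSC : ∑ b, (d (lC b) : ℤ) = d c₃ + d c₂ + ((m : ℤ) - 2) * d c₀ := by
    rw [sum_eq_add_add (fun b => (d (lC b) : ℤ)) (d c₀) x y hxy (fun b hbx hby => by
      show (d (lC b) : ℤ) = d c₀; rw [hlC b hbx hby]), hx, hy]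
  -- `P₂` for a transversal holding two of the three special incidences
  have hP2_of : ∀ q : Fin m → Fin 3, ((q bs = 1 ∧ q x = 2) ∨ (q bs = 1 ∧ q a = 0) ∨ (q x = 2 ∧ q a = 0)) →
      ∑ b, (d ((T 2).2 b) : ℤ) ≤ ∑ b, (d ((T (q b)).2 b) : ℤ) := by
    intro q hq
    rw [T2]
    show ∑ b, (d (lC b) : ℤ) ≤ ∑ b, (d ((T (q b)).2 b) : ℤ)
    rw [hSC]
    have h23' : (d c₂ : ℤ) ≤ d c₃ := by exact_mod_cast h23
    rcases hq with ⟨h1, h2⟩ | ⟨h1, h2⟩ | ⟨h1, h2⟩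
    · have hne : bs ≠ x := by intro e; rw [e, h2] at h1; exact absurd h1 (by decide)
      refine add_add_le_sum (fun b => (d ((T (q b)).2 b) : ℤ)) (d c₀) (d c₃) (d c₂) bs x hne (fun b => hlow _ b) ?_ ?_
      · show (d c₃ : ℤ) ≤ d ((T (q bs)).2 bs); rw [h1, T1]; show (d c₃ : ℤ) ≤ d (lB bs); rw [hbs]
      · show (d c₂ : ℤ) ≤ d ((T (q x)).2 x); rw [h2, T2]; show (d c₂ : ℤ) ≤ d (lC x); rw [hx]; exact h23'
    · have hne : bs ≠ a := by intro e; rw [e, h2] at h1; exact absurd h1 (by decide)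
      refine add_add_le_sum (fun b => (d ((T (q b)).2 b) : ℤ)) (d c₀) (d c₃) (d c₂) bs a hne (fun b => hlow _ b) ?_ ?_
      · show (d c₃ : ℤ) ≤ d ((T (q bs)).2 bs); rw [h1, T1]; show (d c₃ : ℤ) ≤ d (lB bs); rw [hbs]
      · show (d c₂ : ℤ) ≤ d ((T (q a)).2 a); rw [h2, T0]; show (d c₂ : ℤ) ≤ d (lA a); rw [hlA a]
    · have hne : x ≠ a := by intro e; rw [e, h2] at h1; exact absurd h1 (by decide)
      refine add_add_le_sum (fun b => (d ((T (q b)).2 b) : ℤ)) (d c₀) (d c₃) (d c₂) x a hne (fun b => hlow _ b) ?_ ?_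
      · show (d c₃ : ℤ) ≤ d ((T (q x)).2 x); rw [h1, T2]; show (d c₃ : ℤ) ≤ d (lC x); rw [hx]
      · show (d c₂ : ℤ) ≤ d ((T (q a)).2 a); rw [h2, T0]; show (d c₂ : ℤ) ≤ d (lA a); rw [hlA a]
  -- `P₁` for the switched matching
  have hP1 : ∀ b, d ((T (sM b)).2 b) ≤ d ((T 0).2 b) := by
    intro b
    rw [T0]
    show d ((T (sM b)).2 b) ≤ d (lA b)
    rw [hlA b]
    rcases slot_cases 0 1 2 (sM b) (by decide) (by decide) (by decide) with h | h | h
    · rw [h, T0]; show d (lA b) ≤ d c₂; rw [hlA b]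
    · rw [h, T1]; show d (lB b) ≤ d c₂
      have hbbs : b ≠ bs := fun e => hbs1 (e ▸ h)
      rw [hlB b hbbs]; exact h12.le
    · rw [h, T2]; show d (lC b) ≤ d c₂
      have hba : b = a := sM_two b h
      rw [hba]
      by_cases hay : a = y
      · rw [hay, hy]
      · rw [hlC a hax hay]; exact h02.le
  -- `M` differs from `A` at the column `a`
  have hneM : ∃ b, (T (sM b)).1 b ≠ (T 0).1 b := by
    refine ⟨a, ?_⟩
    rw [sM_a, T2, T0]
    show γ a ≠ α a
    intro h
    apply hamv
    rw [hρdef, Equiv.Perm.mul_apply, Equiv.Perm.inv_eq_iff_eq]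
    exact h
  -- pigeonhole: two of the three special incidences in one transversal
  set θ3 : Fin 3 → ℤ := ![θA, θB, θC] with hθ3
  have hdomT : ∀ k, IsDominant d v ε (θ3 k) (T k) := by
    intro k
    fin_cases k
    · exact hA
    · exact hB
    · exact hC
  have hgood : ((s₁ bs = 1 ∧ s₁ x = 2) ∨ (s₁ bs = 1 ∧ s₁ a = 0) ∨ (s₁ x = 2 ∧ s₁ a = 0)) ∨
      ((s₂ bs = 1 ∧ s₂ x = 2) ∨ (s₂ bs = 1 ∧ s₂ a = 0) ∨ (s₂ x = 2 ∧ s₂ a = 0)) := by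
    rcases free_bs with h1 | h1 <;> rcases free_x with h2 | h2 <;> rcases free_a with h3 | h3
    · exact Or.inl (Or.inl ⟨h1, h2⟩)
    · exact Or.inl (Or.inl ⟨h1, h2⟩)
    · exact Or.inl (Or.inr (Or.inl ⟨h1, h3⟩))
    · exact Or.inr (Or.inr (Or.inr ⟨h2, h3⟩))
    · exact Or.inl (Or.inr (Or.inr ⟨h2, h3⟩))
    · exact Or.inr (Or.inr (Or.inl ⟨h1, h3⟩))
    · exact Or.inr (Or.inl ⟨h1, h2⟩)
    · exact Or.inr (Or.inl ⟨h1, h2⟩)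
  rcases hgood with hg | hg
  · exact latin_contra d v ε T θ3 hAB hBC hdomT sM s₂ s₁ (fun b => (hs2M b).symm) (fun b => (hs1M b).symm)
      (fun b => (hs12 b).symm) hMinj hi₂ hi₁ hneM hP1 (hP2_of s₁ hg)
  · exact latin_contra d v ε T θ3 hAB hBC hdomT sM s₁ s₂ (fun b => (hs1M b).symm) (fun b => (hs2M b).symm)
      hs12 hMinj hi₁ hi₂ hneM hP1 (hP2_of s₂ hg)

/-- **the law along a dominant family** (the crux's chains). [this cell] -/
theorem lex_core_law_chain (hm : 4 ≤ m) (d : Fin K → ℕ) (v ε : Fin m → Fin m → Fin K → ℤ) (c₀ c₁ c₂ c₃ : Fin K)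
    (h01 : d c₀ < d c₁) (h12 : d c₁ < d c₂) (h23 : d c₂ ≤ d c₃)
    {n : ℕ} (θ : Fin (n + 1) → ℤ) (p : Fin (n + 1) → Equiv.Perm (Fin m) × (Fin m → Fin K))
    (hθ : StrictMono θ) (hdom : ∀ t, IsDominant d v ε (θ t) (p t))
    {i j k : Fin (n + 1)} (hij : i < j) (hjk : j < k) (bs x y : Fin m) (hxy : x ≠ y)
    (hlA : ∀ b, (p i).2 b = c₂) (hlB : ∀ b, b ≠ bs → (p j).2 b = c₁) (hbs : (p j).2 bs = c₃)
    (hlC : ∀ b, b ≠ x → b ≠ y → (p k).2 b = c₀) (hx : (p k).2 x = c₃) (hy : (p k).2 y = c₂) : False :=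
  lex_core_law hm d v ε c₀ c₁ c₂ c₃ h01 h12 h23 bs x y hxy hlA hlB hbs hlC hx hy (hθ hij) (hθ hjk) (hdom i) (hdom j) (hdom k)

end LexCore

end Summit.ValiantsHypothesis.ValiantsHypothesis.Theorems.KPlusLogSqLaw
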